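import Mathlib
import Summits.ResolutionOfSingularities.ResolutionOfSingularities.Theorems.WildQuotientsWildQuotientResolutionPeelingFrameKLWitness

/-!
# The ℤ9 specimen, brick Z1: order and fixed locus of the descended automorphism `σ̄` (char 3)

(crux stmt-ResolutionOfSingularities-15640 `WildQuotients.WildQuotientResolution`, S1 = stmt-…-17941
`CyclicQuotientFourfolds`, non-linear sector; ℤ9 SPECIMEN of res-L1-w45c-idea-2's card P
(`cardP_g12/Z9-SPECIMEN.md` §0/§4, brick Z1), res-L1-w45c-plan-1 GO 2026-08-27T16:29:20Z / letters
16:29:52Z; [OURS · L1 W4.5c] — NOT a statement of any manuscript; replaces the role of no printed item.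
Prover res-L1-w45c-stub-1. Mould: `JordanFour.pow_prime_eq_one / ne_one / card_zpowers_prime`.)

`τ = σ̄` is the descended ℤ/3 of `𝔸⁴/ℤ9` on `k[x]`: `τ x_b = x_b + x_a`, `τ x_c = x_c + x_b`,
`τ x_d = x_d + f(x_c)` with `f(t) = t³ − x_a² t` (additive in characteristic 3, `f(x_a) = 0`), passengers
fixed. This file records, for the 17941 datum and the K–L bricks of the specimen:

* `pow_three_eq_one`, `ne_one`, `sq_ne_one`, `card_zpowers_eq_three`, `finite_zpowers` — `⟨τ⟩ ≅ ℤ/3`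
  (`τ³ x_d = x_d + 3 x_c³ + 3 f(x_b) = x_d`);
* `zpowers_shape` — every element of `⟨τ⟩` is `1`, `τ` or `τ²`;
* `X_a_mem_span_sub` — `x_a` lies in the augmentation ideal `(g u − u : u)` of every `g ≠ 1` in `⟨τ⟩`
  (the quotient map is étale over `D(x_a)`; the action is free off `V(x_a)`);
* `span_sub_eq` — the augmentation ideal of `τ` is `(x_a, x_b, x_c³ − x_a² x_c)` (generators'
  increments suffice, `PeelingFrame.forall_sub_mem_of_adjoin_eq_top`), and `zeroLocus_span_sub` — its
  zero locus is the AXIS `V(x_a, x_b, x_c)` (set-theoretic fixed locus = a curve of wild ℤ/3-points).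
-/

-- single-problem summit: the doubled namespace component `ResolutionOfSingularities` is forced
set_option linter.dupNamespace false

noncomputable section

open MvPolynomial

namespace Summit.ResolutionOfSingularities.ResolutionOfSingularities.Theorems.WildQuotientResolution.Z9Peeled

variable (k : Type) [Field k] (n : ℕ) (τ : MvPolynomial (Fin n) k ≃ₐ[k] MvPolynomial (Fin n) k)
  (a b c d : Fin n) (hab : a ≠ b) (hac : a ≠ c) (had : a ≠ d)
  (hb : τ (X b) = X b + X a) (hc : τ (X c) = X c + X b)
  (hd : τ (X d) = X d + X c ^ 3 - X a ^ 2 * X c)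
  (hτ : ∀ i, i ≠ b → i ≠ c → i ≠ d → τ (X i) = X i)

/-! ## Order three -/

include hab hac had hb hc hd hτ in
/-- **`τ³ = 1`** in characteristic 3: `τ³ x_b = x_b + 3x_a`, `τ³ x_c = x_c + 3x_b + 3x_a`, and
`τ³ x_d = x_d + Tr f(x_c)` with `Tr f(x_c) = f(x_c) + f(x_c + x_b) + f(x_c + 2x_b + x_a) = 3 f(x_c) + 3 f(x_b)
+ f(x_a) = 0` (`f(t) = t³ − x_a²t` is additive by `(s+t)³ = s³ + t³`, and `f(x_a) = 0`). [OURS · L1 W4.5c] -/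
theorem pow_three_eq_one [CharP k 3] : τ ^ 3 = 1 := by
  classical
  haveI : Fact (Nat.Prime 3) := ⟨Nat.prime_three⟩
  have h3 : (3 : MvPolynomial (Fin n) k) = 0 := CharP.cast_eq_zero _ 3
  have ha : τ (X a) = X a := hτ a hab hac had
  have hcube : ∀ s t : MvPolynomial (Fin n) k, (s + t) ^ 3 = s ^ 3 + t ^ 3 :=
    fun s t => add_pow_char s t 3
  have key : ((τ ^ 3 : MvPolynomial (Fin n) k ≃ₐ[k] MvPolynomial (Fin n) k) :
      MvPolynomial (Fin n) k →ₐ[k] MvPolynomial (Fin n) k) = AlgHom.id k _ := by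
    refine MvPolynomial.algHom_ext fun i => ?_
    change (τ ^ 3) (X i) = X i
    rw [pow_succ, pow_two, AlgEquiv.mul_apply, AlgEquiv.mul_apply]
    by_cases hib : i = b
    · subst hib
      have h : τ (τ (τ (X i))) = X i + 3 * X a := by simp only [hb, ha, map_add]; ring
      rw [h, h3, zero_mul, add_zero]
    by_cases hic : i = c
    · subst hic
      have h : τ (τ (τ (X i))) = X i + 3 * X b + 3 * X a := by
        simp only [hc, hb, ha, map_add]; ring
      rw [h, h3, zero_mul, zero_mul, add_zero, add_zero]
    by_cases hid : i = d
    · subst hid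
      have h1 : τ (X c ^ 3 - X a ^ 2 * X c) = (X c ^ 3 - X a ^ 2 * X c) + (X b ^ 3 - X a ^ 2 * X b) := by
        rw [map_sub, map_pow, map_mul, map_pow, hc, ha, hcube]; ring
      have h2 : τ (X b ^ 3 - X a ^ 2 * X b) = X b ^ 3 - X a ^ 2 * X b := by
        rw [map_sub, map_pow, map_mul, map_pow, hb, ha, hcube]; ring
      have hd' : τ (X i) = X i + (X c ^ 3 - X a ^ 2 * X c) := by rw [hd]; ring
      have h : τ (τ (τ (X i))) =
          X i + 3 * (X c ^ 3 - X a ^ 2 * X c) + 3 * (X b ^ 3 - X a ^ 2 * X b) := by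
        rw [hd', map_add, hd', h1, map_add, map_add, map_add, hd', h1, h2]; ring
      rw [h, h3, zero_mul, zero_mul, add_zero, add_zero]
    · rw [hτ i hib hic hid, hτ i hib hic hid, hτ i hib hic hid]
  apply AlgEquiv.ext
  intro r
  have := DFunLike.congr_fun key r
  simpa using this

include hb in
/-- **`τ ≠ 1`** (`τ x_b = x_b + x_a ≠ x_b`). [folklore] -/
theorem ne_one : τ ≠ 1 := by
  intro h
  have h1 := hb
  rw [h, AlgEquiv.one_apply] at h1
  have hX : (X a : MvPolynomial (Fin n) k) = 0 := by
    have := congrArg (fun g => g - X b) h1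
    simp only [sub_self, add_sub_cancel_left] at this
    exact this.symm
  exact MvPolynomial.X_ne_zero _ hX

include hab hac had hb hτ in
/-- **`τ² ≠ 1`** (`τ² x_b = x_b + 2x_a ≠ x_b` since `2 ≠ 0` in characteristic 3). [folklore] -/
theorem sq_ne_one [CharP k 3] : τ ^ 2 ≠ 1 := by
  intro h
  have ha : τ (X a) = X a := hτ a hab hac had
  have h1 : (τ ^ 2) (X b) = X b + 2 * X a := by
    rw [pow_two, AlgEquiv.mul_apply, hb, map_add, hb, ha]; ring
  rw [h, AlgEquiv.one_apply] at h1
  have h2 : (2 : MvPolynomial (Fin n) k) * X a = 0 := by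
    have := congrArg (fun g => g - X b) h1
    simp only [sub_self, add_sub_cancel_left] at this
    exact this.symm
  have h2' : (2 : MvPolynomial (Fin n) k) ≠ 0 := by
    rw [Ne, show (2 : MvPolynomial (Fin n) k) = ((2 : ℕ) : MvPolynomial (Fin n) k) by norm_cast,
      CharP.cast_eq_zero_iff (MvPolynomial (Fin n) k) 3]
    norm_num
  exact (mul_ne_zero h2' (MvPolynomial.X_ne_zero a)) h2

include hab hac had hb hc hd hτ in
/-- **`|⟨τ⟩| = 3`.** [folklore] -/
theorem card_zpowers_eq_three [CharP k 3] : Nat.card (Subgroup.zpowers τ) = 3 := by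
  haveI : Fact (Nat.Prime 3) := ⟨Nat.prime_three⟩
  rw [Nat.card_zpowers, orderOf_eq_prime (pow_three_eq_one k n τ a b c d hab hac had hb hc hd hτ)
    (ne_one k n τ a b hb)]

include hab hac had hb hc hd hτ in
/-- `⟨τ⟩` is finite (the `[Finite (zpowers σ̄)]` instance argument of
`AffineQuotient.hasResolution_mvPolynomial_fixedPoints_zpowers_of_model`). [folklore] -/
theorem finite_zpowers [CharP k 3] : Finite (Subgroup.zpowers τ) :=
  Nat.finite_of_card_ne_zero (by
    rw [card_zpowers_eq_three k n τ a b c d hab hac had hb hc hd hτ]; norm_num)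

include hab hac had hb hc hd hτ in
/-- **Shape of `⟨τ⟩`**: every element is `1`, `τ` or `τ²`. [folklore] -/
theorem zpowers_shape [CharP k 3] (g : MvPolynomial (Fin n) k ≃ₐ[k] MvPolynomial (Fin n) k)
    (hg : g ∈ Subgroup.zpowers τ) : g = 1 ∨ g = τ ∨ g = τ ^ 2 := by
  obtain ⟨m, rfl⟩ := Subgroup.mem_zpowers_iff.mp hg
  have h3 := pow_three_eq_one k n τ a b c d hab hac had hb hc hd hτ
  have hdecomp : τ ^ m = τ ^ (m % 3).toNat := by
    have hm : m = 3 * (m / 3) + m % 3 := (Int.mul_ediv_add_emod m 3).symm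
    have hnonneg : 0 ≤ m % 3 := Int.emod_nonneg m (by norm_num)
    conv_lhs => rw [hm, zpow_add, zpow_mul]
    rw [show (τ ^ (3 : ℤ)) = τ ^ (3 : ℕ) from zpow_natCast τ 3, h3, one_zpow, one_mul,
      ← zpow_natCast, Int.toNat_of_nonneg hnonneg]
  have hlt : (m % 3).toNat < 3 := by
    have := Int.emod_lt_of_pos m (show (0 : ℤ) < 3 by norm_num)
    omega
  rw [hdecomp]
  interval_cases (m % 3).toNat
  · left; rw [pow_zero]
  · right; left; rw [pow_one]
  · right; right; rfl

/-! ## Augmentation ideals and the fixed axis -/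

include hab hac had hb hc hd hτ in
/-- **`x_a` lies in the augmentation ideal of every `g ≠ 1` in `⟨τ⟩`**: `τ x_b − x_b = x_a` and
`τ² x_b − x_b = 2 x_a` with `2` a unit in characteristic 3. Hence the quotient by `⟨τ⟩` is étale over
`D(x_a)` and the action is free off `V(x_a)`. [OURS · L1 W4.5c] -/
theorem X_a_mem_span_sub [CharP k 3] (g : MvPolynomial (Fin n) k ≃ₐ[k] MvPolynomial (Fin n) k)
    (hg : g ∈ Subgroup.zpowers τ) (hg1 : g ≠ 1) :
    (X a : MvPolynomial (Fin n) k) ∈ Ideal.span (Set.range fun u : MvPolynomial (Fin n) k => g u - u) := by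
  have ha : τ (X a) = X a := hτ a hab hac had
  rcases zpowers_shape k n τ a b c d hab hac had hb hc hd hτ g hg with h1 | hτ1 | hτ2
  · exact absurd h1 hg1
  · subst hτ1
    have h : g (X b) - X b = X a := by rw [hb]; ring
    rw [← h]
    exact Ideal.subset_span ⟨X b, rfl⟩
  · subst hτ2
    have h : (τ ^ 2) (X b) - X b = 2 * X a := by
      rw [pow_two, AlgEquiv.mul_apply, hb, map_add, hb, ha]; ring
    have hmem : (2 : MvPolynomial (Fin n) k) * X a ∈
        Ideal.span (Set.range fun u : MvPolynomial (Fin n) k => (τ ^ 2) u - u) := by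
      rw [← h]; exact Ideal.subset_span ⟨X b, rfl⟩
    -- `2 · 2 = 4 = 1` in characteristic 3
    have h4 : (2 : MvPolynomial (Fin n) k) * 2 = 1 := by
      have h3 : (3 : MvPolynomial (Fin n) k) = 0 := CharP.cast_eq_zero _ 3
      have : (2 : MvPolynomial (Fin n) k) * 2 = 3 + 1 := by norm_num
      rw [this, h3, zero_add]
    have := Ideal.mul_mem_left _ (2 : MvPolynomial (Fin n) k) hmem
    rwa [← mul_assoc, h4, one_mul] at this

include hab hac had hb hc hd hτ in
/-- **The augmentation ideal of `τ`** is `(x_a, x_b, x_c³ − x_a² x_c)`: the increments of the generators are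
`0` (passengers, `x_a`), `x_a`, `x_b`, `x_c³ − x_a²x_c`, and generators suffice
(`PeelingFrame.forall_sub_mem_of_adjoin_eq_top`). [OURS · L1 W4.5c] -/
theorem span_sub_eq :
    Ideal.span (Set.range fun u : MvPolynomial (Fin n) k => τ u - u) =
      Ideal.span {(X a : MvPolynomial (Fin n) k), X b, X c ^ 3 - X a ^ 2 * X c} := by
  classical
  have ha : τ (X a) = X a := hτ a hab hac had
  set J : Ideal (MvPolynomial (Fin n) k) :=
    Ideal.span {(X a : MvPolynomial (Fin n) k), X b, X c ^ 3 - X a ^ 2 * X c} with hJ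
  have hJa : (X a : MvPolynomial (Fin n) k) ∈ J := Ideal.subset_span (by simp)
  have hJb : (X b : MvPolynomial (Fin n) k) ∈ J := Ideal.subset_span (by simp)
  have hJc : (X c ^ 3 - X a ^ 2 * X c : MvPolynomial (Fin n) k) ∈ J := Ideal.subset_span (by simp)
  apply le_antisymm
  · -- increments of generators lie in `J`
    rw [Ideal.span_le]
    rintro _ ⟨u, rfl⟩
    refine PeelingFrame.forall_sub_mem_of_adjoin_eq_top (τ : MvPolynomial (Fin n) k →ₐ[k] _) J
      (G := Set.range (X : Fin n → MvPolynomial (Fin n) k)) (MvPolynomial.adjoin_range_X) ?_ u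
    rintro _ ⟨i, rfl⟩
    change τ (X i) - X i ∈ J
    by_cases hib : i = b
    · rw [hib, hb, add_sub_cancel_left]; exact hJa
    by_cases hic : i = c
    · rw [hic, hc, add_sub_cancel_left]; exact hJb
    by_cases hid : i = d
    · have h : τ (X i) - X i = X c ^ 3 - X a ^ 2 * X c := by rw [hid, hd]; ring
      rw [h]; exact hJc
    · rw [hτ i hib hic hid, sub_self]; exact J.zero_mem
  · rw [Ideal.span_le]
    intro x hx
    simp only [Set.mem_insert_iff, Set.mem_singleton_iff] at hx
    rcases hx with rfl | rfl | rfl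
    · have h : τ (X b) - X b = X a := by rw [hb]; ring
      rw [← h]; exact Ideal.subset_span ⟨X b, rfl⟩
    · have h : τ (X c) - X c = X b := by rw [hc]; ring
      rw [← h]; exact Ideal.subset_span ⟨X c, rfl⟩
    · have h : τ (X d) - X d = X c ^ 3 - X a ^ 2 * X c := by rw [hd]; ring
      rw [← h]; exact Ideal.subset_span ⟨X d, rfl⟩

include hab hac had hb hc hd hτ in
/-- **The fixed locus is the axis**: the zero locus of the augmentation ideal of `τ` in `Spec k[x]` is
`V(x_a, x_b, x_c)` (a prime containing `x_a` and `x_c³ − x_a²x_c` contains `x_c`). [OURS · L1 W4.5c] -/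
theorem zeroLocus_span_sub :
    PrimeSpectrum.zeroLocus (Ideal.span (Set.range fun u : MvPolynomial (Fin n) k => τ u - u) :
        Set (MvPolynomial (Fin n) k)) =
      PrimeSpectrum.zeroLocus {(X a : MvPolynomial (Fin n) k), X b, X c} := by
  rw [span_sub_eq k n τ a b c d hab hac had hb hc hd hτ, PrimeSpectrum.zeroLocus_span]
  ext 𝔭
  simp only [PrimeSpectrum.mem_zeroLocus, Set.insert_subset_iff, Set.singleton_subset_iff,
    SetLike.mem_coe]
  constructor
  · rintro ⟨ha, hb', hc'⟩
    refine ⟨ha, hb', ?_⟩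
    have h3 : (X c : MvPolynomial (Fin n) k) ^ 3 ∈ 𝔭.asIdeal := by
      have := 𝔭.asIdeal.add_mem hc' (𝔭.asIdeal.mul_mem_right (X a * X c) ha)
      have e : X c ^ 3 - X a ^ 2 * X c + X a * (X a * X c) = (X c : MvPolynomial (Fin n) k) ^ 3 := by
        ring
      rwa [e] at this
    exact 𝔭.isPrime.mem_of_pow_mem 3 h3
  · rintro ⟨ha, hb', hc'⟩
    refine ⟨ha, hb', ?_⟩
    have e : (X c ^ 3 - X a ^ 2 * X c : MvPolynomial (Fin n) k) = (X c ^ 2 - X a ^ 2) * X c := by ring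
    rw [e]
    exact 𝔭.asIdeal.mul_mem_left _ hc'

end Summit.ResolutionOfSingularities.ResolutionOfSingularities.Theorems.WildQuotientResolution.Z9Peeled

end
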